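import Literature.Computability.QuantumComplexity.BooleanFunctionOracle
import Literature.Computability.QuantumComplexity.ApproxStabilizerRankTypicalProofs
import Literature.Computability.Cryptography.TCount
import HarnessLib

/-!
# Exact Clifford+`T` synthesis of sign states by phase kickback

Topic `Literature/Computability/QuantumComplexity`. The **sign state** (binary phase state) of a
Boolean function `f : {0,1}ⁿ → {0,1}`,
`|φ_f⟩ = 2^{-n/2} Σₓ (−1)^{f(x)} |x⟩` (`ApproxRankTypical.signVec f`), is prepared EXACTLY — no
approximation, no rotation synthesis — from `|0…0⟩` by Hadamards on the address register, one call
to the standard oracle `U_f : |x⟩|y⟩ ↦ |x⟩|y ⊕ f(x)⟩` on the target prepared in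
`|−⟩ = H X|0⟩` (phase kickback: `U_f |x⟩|−⟩ = (−1)^{f(x)} |x⟩|−⟩`, Nielsen–Chuang 2010, §6.1.1,
eq. (6.2)–(6.5); Deutsch–Jozsa, §1.4.4), and `X H` returning the target to `|0⟩`. When `U_f` is
an exact reversible circuit `ops` over `{NOT, CNOT, Toffoli}` (compiled by `revCompile`,
`ReversibleCliffordT.lean`), the whole circuit is an oracle-free Clifford+`T` circuit whose only
`T` gates are the `7` of each compiled Toffoli (`toffoliWord`): `T`-count `= 7 · toffCount ops`
("Boolean phase oracles … can be implemented using Clifford+T circuits with zero error … AND gate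
into Toffoli gate (which has a constant T-count)", Gosset–Kothari–Wu 2024, p. 8, Lemma 2.1 and
Remark 2.2). Main result: `signState_exact_synthesis`. This is step S3 of the in-tree discharge of
Mehraban–Tahmasbi 2024, Thm 3.1 (`MehrabanTahmasbi2024_approxRank_magicT_quadratic`) with the
Low–Kliuchnikov–Schaeffer synthesis replaced by exact synthesis of the sign-state witness.

## References

* M. A. Nielsen, I. L. Chuang, *Quantum Computation and Quantum Information*, CUP 2010, §1.4.4
  (`H^{⊗n}|0⟩`, Deutsch–Jozsa), §6.1.1 (the oracle on `|−⟩`: phase kickback) [NielsenChuang2010].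
* D. Gosset, R. Kothari, K. Wu, *Quantum state preparation with optimal T-count*, arXiv:2411.04790,
  Lemma 2.1, Remark 2.2 (p. 8) [GossetKothariWu2024].
* S. Mehraban, M. Tahmasbi, arXiv:2305.10277, §3.4 [MehrabanTahmasbi2024].
-/

noncomputable section

namespace Literature.Computability.QuantumComplexity

open Cryptography Matrix
open ApproxRankTypical (signVec sgn card_QReg)

/-! ### `T`-counts of the compiled words -/

section TCounts

variable {N : ℕ}

/-- The `T`-count of a concatenation of gate lists. [cite: GossetKothariWu2024, Remark 2.2 (arXiv p. 8)] -/
theorem tCount_mk_append (l₁ l₂ : List (QGate cliffordT N)) :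
    (⟨l₁ ++ l₂⟩ : QCircuit cliffordT N).tCount =
      (⟨l₁⟩ : QCircuit cliffordT N).tCount + (⟨l₂⟩ : QCircuit cliffordT N).tCount :=
  QCircuit.tCount_append ⟨l₁⟩ ⟨l₂⟩

/-- `X = HSSH` has no `T` gate. [cite: GossetKothariWu2024, Remark 2.2 (arXiv p. 8)] -/
@[simp] theorem tCount_xWord (i : Fin N) : (⟨xWord i⟩ : QCircuit cliffordT N).tCount = 0 := by
  simp [xWord, QCircuit.tCount, hOn, sOn]

/-- A layer of Hadamards has no `T` gate. [cite: GossetKothariWu2024, Remark 2.2 (arXiv p. 8)] -/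
@[simp] theorem tCount_map_hOn (ws : List (Fin N)) :
    (⟨ws.map hOn⟩ : QCircuit cliffordT N).tCount = 0 := by
  induction ws with
  | nil => rfl
  | cons w ws ih =>
    rw [List.map_cons, QCircuit.tCount_cons, ih]
    simp [hOn]

/-- The compiled Toffoli word has exactly `7` `T` gates ("AND gate into Toffoli gate (which has a
constant T-count)"). [cite: GossetKothariWu2024, Remark 2.2 (arXiv p. 8)] -/
theorem tCount_compile (op : RevOp N) :
    (⟨op.compile⟩ : QCircuit cliffordT N).tCount =
      match op with | .toffoli _ _ _ _ _ _ => 7 | _ => 0 := by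
  cases op with
  | not i => exact tCount_xWord i
  | cnot i j h => simp [RevOp.compile, QCircuit.tCount, cnotOn]
  | toffoli a b c hab hac hbc =>
    simp [RevOp.compile, toffoliWord, cczWord, QCircuit.tCount, hOn, sOn, tOn, cnotOn]

/-- **The `T`-count of a compiled reversible circuit is `7` per Toffoli gate** (`NOT`, `CNOT`
compile to Clifford words). [cite: GossetKothariWu2024, Remark 2.2 (arXiv p. 8)] -/
theorem tCount_revCompile (ops : List (RevOp N)) :
    (⟨revCompile ops⟩ : QCircuit cliffordT N).tCount = 7 * toffCount ops := by
  induction ops with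
  | nil => simp [revCompile]
  | cons op ops ih =>
    rw [revCompile_cons, tCount_mk_append, ih, tCount_compile]
    cases op <;> simp [mul_add, add_comm]

end TCounts

/-! ### The kickback circuit -/

section Kickback

variable {n a : ℕ}

/-- The list of the address wires. [cite: GossetKothariWu2024, Lemma 2.1 (arXiv p. 8)] -/
def addrWires (n a : ℕ) : List (Fin (n + (1 + a))) := (List.finRange n).map (addrWire n a)

/-- Membership in the address-wire list. [cite: GossetKothariWu2024, Lemma 2.1 (arXiv p. 8)] -/
theorem mem_addrWires_iff (w : Fin (n + (1 + a))) : w ∈ addrWires n a ↔ ∃ i, w = addrWire n a i := by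
  simp [addrWires, eq_comm]

/-- The address wires are pairwise distinct. [cite: GossetKothariWu2024, Lemma 2.1 (arXiv p. 8)] -/
theorem addrWires_nodup : (addrWires n a).Nodup :=
  (List.nodup_finRange n).map addrWire_injective

/-- There are `n` address wires. [cite: GossetKothariWu2024, Lemma 2.1 (arXiv p. 8)] -/
@[simp] theorem length_addrWires : (addrWires n a).length = n := by simp [addrWires]

/-- **The kickback circuit** of a reversible oracle circuit `ops` on the layout
`address ‖ target ‖ ancillas`: `X_t, H_t` (target to `|−⟩`), `H` on every address wire, the
compiled oracle, `H_t, X_t` (target back to `|0⟩`). [cite: NielsenChuang2010, §6.1.1 (eq. (6.4)–(6.5))] -/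
def kickbackCircuit (ops : List (RevOp (n + (1 + a)))) : QCircuit cliffordT (n + (1 + a)) :=
  ((⟨xWord (tgtWire n a)⟩ : QCircuit cliffordT _).append
      ⟨hOn (tgtWire n a) :: (addrWires n a).map hOn⟩).append
    ((⟨revCompile ops⟩ : QCircuit cliffordT _).append ⟨hOn (tgtWire n a) :: xWord (tgtWire n a)⟩)

/-- The kickback circuit is oracle-free (the "oracle" is the compiled reversible circuit).
[cite: NielsenChuang2010, §6.1.1] -/
theorem kickbackCircuit_isOracleFree (ops : List (RevOp (n + (1 + a)))) :
    (kickbackCircuit ops).IsOracleFree := by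
  intro g hg
  simp only [kickbackCircuit, QCircuit.gates_append, List.mem_append, List.mem_cons, List.mem_map] at hg
  rcases hg with (hg | rfl | ⟨w, -, rfl⟩) | (hg | rfl | hg)
  · exact xWord_isOracleFree _ g hg
  · exact hOn_isOracleFree _
  · exact hOn_isOracleFree _
  · exact revCompile_isOracleFree ops g hg
  · exact hOn_isOracleFree _
  · exact xWord_isOracleFree _ g hg

/-- **`T`-count of the kickback circuit**: exactly `7` per Toffoli gate of the oracle circuit.
[cite: GossetKothariWu2024, Remark 2.2 (arXiv p. 8)] -/
theorem tCount_kickbackCircuit (ops : List (RevOp (n + (1 + a)))) :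
    (kickbackCircuit ops).tCount = 7 * toffCount ops := by
  rw [kickbackCircuit, QCircuit.tCount_append, QCircuit.tCount_append, QCircuit.tCount_append,
    ← List.map_cons,
    tCount_map_hOn, QCircuit.tCount_cons, tCount_xWord, tCount_revCompile]
  simp [hOn]

/-! ### Semantics, gate by gate -/

/-- `mulVec` distributes over finite sums of vectors. [cite: NielsenChuang2010, §2.1] -/
theorem mulVec_finset_sum {ι : Type*} {m : ℕ} (M : Matrix (QReg m) (QReg m) ℂ) (s : Finset ι)
    (v : ι → QReg m → ℂ) : M *ᵥ (∑ i ∈ s, v i) = ∑ i ∈ s, M *ᵥ v i := by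
  classical
  induction s using Finset.induction_on with
  | empty => simp
  | insert i s hi ih => rw [Finset.sum_insert hi, Finset.sum_insert hi, Matrix.mulVec_add, ih]

/-- `X` on the target flips the target bit of a layout. [cite: NielsenChuang2010, §6.1.1] -/
theorem xWord_mulVec_layout (A : Language Bool) (x : QReg n) (b : Bool) :
    (⟨xWord (tgtWire n a)⟩ : QCircuit cliffordT _).toMatrix A *ᵥ basisState (layout x b) =
      basisState (layout x (!b)) := by
  rw [xWord_mulVec_basisState, layout_tgtWire, update_layout_tgtWire]

/-- `H` on the target of a layout: `|x⟩|b⟩ ↦ (|x⟩|0⟩ + (−1)^b |x⟩|1⟩)/√2`.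
[cite: NielsenChuang2010, §6.1.1] -/
theorem hOn_tgt_mulVec_layout (A : Language Bool) (x : QReg n) (b : Bool) :
    (hOn (tgtWire n a)).toMatrix A *ᵥ basisState (layout x b) =
      invSqrt2 • (basisState (layout x false) +
        (if b then (-1 : ℂ) else 1) • basisState (layout (a := a) x true)) := by
  rw [hOn_mulVec_basisState', update_layout_tgtWire, update_layout_tgtWire, layout_tgtWire]

/-- The uniform superposition of the layouts with target bit `b` (unnormalised).
[cite: NielsenChuang2010, §1.4.4] -/
def layoutSum (n a : ℕ) (b : Bool) : QReg (n + (1 + a)) → ℂ := ∑ x : QReg n, basisState (layout x b)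

/-- Pointwise form of a weighted sum over the layouts: `Σₓ g(x) [z = x ‖ b ‖ 0^a]` is `g` of the
address of `z` if `z` has target bit `b` and clean ancillas, else `0`.
[cite: GossetKothariWu2024, Lemma 2.1 (arXiv p. 8)] -/
theorem sum_ite_eq_layout' {R : Type*} [AddCommMonoid R] (g : QReg n → R) (z : QReg (n + (1 + a)))
    (b : Bool) :
    (∑ x : QReg n, if z = layout x b then g x else 0) =
      if z (tgtWire n a) = b ∧ ∀ j, z (ancWire n a j) = false then g (fun i => z (addrWire n a i))
        else 0 := by
  by_cases hP : z (tgtWire n a) = b ∧ ∀ j, z (ancWire n a j) = false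
  · rw [if_pos hP, Finset.sum_eq_single (fun i => z (addrWire n a i))]
    · rw [if_pos ((eq_layout_iff z _ b).2 ⟨rfl, hP⟩)]
    · intro x _ hx
      exact if_neg fun h => hx ((eq_layout_iff z x b).1 h).1.symm
    · intro h; exact absurd (Finset.mem_univ _) h
  · rw [if_neg hP]
    exact Finset.sum_eq_zero fun x _ => if_neg fun h => hP ((eq_layout_iff z x b).1 h).2

/-- A label agrees with `0ⁿ ‖ b ‖ 0^a` off the address wires iff its target bit is `b` and its
ancillas are clean. [cite: GossetKothariWu2024, Lemma 2.1 (arXiv p. 8)] -/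
theorem agree_off_addrWires_iff (z : QReg (n + (1 + a))) (b : Bool) :
    (∀ j, j ∉ addrWires n a → z j = layout (a := a) (fun _ : Fin n => false) b j) ↔
      z (tgtWire n a) = b ∧ ∀ j, z (ancWire n a j) = false := by
  constructor
  · intro h
    refine ⟨?_, fun j => ?_⟩
    · have := h (tgtWire n a) (fun hm => by
        obtain ⟨i, hi⟩ := (mem_addrWires_iff _).1 hm
        exact addrWire_ne_tgtWire i hi.symm)
      rwa [layout_tgtWire] at this
    · have := h (ancWire n a j) (fun hm => by
        obtain ⟨i, hi⟩ := (mem_addrWires_iff _).1 hm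
        exact addrWire_ne_ancWire i j hi.symm)
      rwa [layout_ancWire] at this
  · rintro ⟨hb, hanc⟩ j hj
    rcases wire_cases j with ⟨i, rfl⟩ | rfl | ⟨l, rfl⟩
    · exact absurd ((mem_addrWires_iff _).2 ⟨i, rfl⟩) hj
    · rw [layout_tgtWire, hb]
    · rw [layout_ancWire, hanc l]

/-- **The Hadamard layer on the address register**: `H^{⊗n} |0ⁿ⟩|b⟩|0^a⟩ = 2^{-n/2} Σₓ |x⟩|b⟩|0^a⟩`.
[cite: NielsenChuang2010, §1.4.4] -/
theorem hadamards_mulVec_layout_zero (b : Bool) :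
    (⟨(addrWires n a).map hOn⟩ : QCircuit cliffordT _).toMatrix 0 *ᵥ
        basisState (layout (a := a) (fun _ : Fin n => false) b) =
      invSqrt2 ^ n • layoutSum n a b := by
  rw [hadamards_mulVec_basisState _ addrWires_nodup _ (fun i hi => by
    obtain ⟨j, rfl⟩ := (mem_addrWires_iff i).1 hi
    exact layout_addrWire _ _ _)]
  funext z
  simp only [layoutSum, Pi.smul_apply, Finset.sum_apply, basisState_apply, smul_eq_mul,
    length_addrWires]
  rw [sum_ite_eq_layout (1 : ℂ) z b]
  by_cases hP : z (tgtWire n a) = b ∧ ∀ j, z (ancWire n a j) = false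
  · rw [if_pos hP, if_pos ((agree_off_addrWires_iff z b).2 hP), mul_one]
  · rw [if_neg hP, if_neg (fun h => hP ((agree_off_addrWires_iff z b).1 h)), mul_zero]

/-- **Phase kickback.** If the reversible circuit `ops` computes `f` into the target
(`|x⟩|b⟩|0^a⟩ ↦ |x⟩|b ⊕ f(x)⟩|0^a⟩`), then on `Σₓ (|x⟩|0⟩ − |x⟩|1⟩)|0^a⟩ = √2 Σₓ |x⟩|−⟩|0^a⟩` its
compilation acts as the phase `(−1)^{f(x)}`. [cite: NielsenChuang2010, §6.1.1 (eq. (6.4))] -/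
theorem revCompile_mulVec_layoutSum_sub (f : QReg n → Bool) (ops : List (RevOp (n + (1 + a))))
    (hops : ∀ (x : QReg n) (b : Bool), revEval ops (layout x b) = layout x (xor b (f x))) :
    (⟨revCompile ops⟩ : QCircuit cliffordT _).toMatrix 0 *ᵥ (layoutSum n a false - layoutSum n a true) =
      ∑ x : QReg n, (if f x then (-1 : ℂ) else 1) •
        (basisState (layout (a := a) x false) - basisState (layout x true)) := by
  rw [layoutSum, layoutSum, ← Finset.sum_sub_distrib, mulVec_finset_sum]
  refine Finset.sum_congr rfl fun x _ => ?_
  rw [Matrix.mulVec_sub, revCompile_mulVec_basisState, revCompile_mulVec_basisState, hops, hops]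
  cases f x <;> simp

/-- `H` on the target maps `|x⟩(|0⟩ − |1⟩)|0^a⟩` to `√2 |x⟩|1⟩|0^a⟩`.
[cite: NielsenChuang2010, §6.1.1 (eq. (6.5))] -/
theorem hOn_tgt_mulVec_sub (A : Language Bool) (x : QReg n) :
    (hOn (tgtWire n a)).toMatrix A *ᵥ (basisState (layout (a := a) x false) - basisState (layout x true)) =
      (2 * invSqrt2) • basisState (layout (a := a) x true) := by
  rw [Matrix.mulVec_sub, hOn_tgt_mulVec_layout, hOn_tgt_mulVec_layout]
  simp only [Bool.false_eq_true, if_false, if_true, one_smul, neg_smul, smul_add, smul_neg]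
  funext z
  simp only [Pi.sub_apply, Pi.add_apply, Pi.neg_apply, Pi.smul_apply, smul_eq_mul]
  ring

/-- `(1/√2)^{n+1} · 2/√2 = (1/√2)^n`. [cite: NielsenChuang2010, §1.4.4] -/
theorem invSqrt2_pow_succ_mul : invSqrt2 ^ (n + 1) * (2 * invSqrt2) = invSqrt2 ^ n := by
  rw [pow_succ, mul_assoc, mul_left_comm invSqrt2 2, invSqrt2_mul_invSqrt2]
  ring

/-- The amplitude of a sign state: `ε_f(x)/√(2ⁿ) = (−1)^{f(x)} (1/√2)ⁿ`.
[cite: MehrabanTahmasbi2024, §3.4 (arXiv p. 14)] -/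
theorem signVec_apply_eq (f : QReg n → Bool) (x : QReg n) :
    signVec f x = (if f x then (-1 : ℂ) else 1) * invSqrt2 ^ n := by
  rw [signVec]
  rw [card_QReg, Nat.cast_pow, Nat.cast_ofNat, sqrt_two_pow, Complex.ofReal_div,
    Complex.ofReal_pow, invSqrt2, div_eq_mul_inv, one_div, inv_pow]
  cases f x <;> simp [sgn]

/-- The last `1 + a` bits of a label vanish iff its target bit is `0` and its ancillas are clean.
[cite: GossetKothariWu2024, Lemma 2.1 (arXiv p. 8)] -/
theorem tail_eq_zero_iff (z : QReg (n + (1 + a))) :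
    (fun j : Fin (1 + a) => z (Fin.natAdd n j)) = (fun _ => false) ↔
      z (tgtWire n a) = false ∧ ∀ j, z (ancWire n a j) = false := by
  constructor
  · intro h
    exact ⟨congrFun h (Fin.castAdd a 0), fun j => congrFun h (Fin.natAdd 1 j)⟩
  · rintro ⟨h0, h1⟩
    funext j
    induction j using Fin.addCases with
    | left l => rw [Subsingleton.elim l 0]; exact h0
    | right j => exact h1 j

/-- **The sign state on the layout**: `|φ_f⟩ ⊗ |0^{1+a}⟩ = (1/√2)ⁿ Σₓ (−1)^{f(x)} |x⟩|0⟩|0^a⟩`.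
[cite: MehrabanTahmasbi2024, §3.4 (arXiv p. 14)] -/
theorem tensorVec_signVec_zeroState (f : QReg n → Bool) :
    tensorVec (signVec f) (zeroState (1 + a)) =
      invSqrt2 ^ n • ∑ x : QReg n, (if f x then (-1 : ℂ) else 1) • basisState (layout (a := a) x false) := by
  funext z
  simp only [tensorVec, zeroState, Pi.smul_apply, Finset.sum_apply, basisState_apply, smul_eq_mul,
    mul_ite, mul_one, mul_zero]
  rw [sum_ite_eq_layout' (fun x => if f x then (-1 : ℂ) else 1) z false, signVec_apply_eq]
  have htail := tail_eq_zero_iff z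
  by_cases hP : z (tgtWire n a) = false ∧ ∀ j, z (ancWire n a j) = false
  · rw [if_pos hP, if_pos (htail.2 hP)]
    exact mul_comm _ _
  · rw [if_neg hP, if_neg (fun h => hP (htail.1 h)), mul_zero]

/-- **The kickback circuit prepares the sign state exactly**:
`kickbackCircuit ops |0…0⟩ = |φ_f⟩ ⊗ |0^{1+a}⟩` whenever `ops` computes `f` into the target with
clean ancillas. [cite: NielsenChuang2010, §6.1.1 (eq. (6.2)–(6.5))] -/
theorem kickbackCircuit_mulVec_zeroState (f : QReg n → Bool) (ops : List (RevOp (n + (1 + a))))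
    (hops : ∀ (x : QReg n) (b : Bool), revEval ops (layout x b) = layout x (xor b (f x))) :
    (kickbackCircuit ops).toMatrix 0 *ᵥ zeroState (n + (1 + a)) =
      tensorVec (signVec f) (zeroState (1 + a)) := by
  have hz : zeroState (n + (1 + a)) = basisState (layout (a := a) (fun _ : Fin n => false) false) := by
    rw [zeroState, zero_eq_layout]
  rw [kickbackCircuit, QCircuit.toMatrix_append, QCircuit.toMatrix_append, QCircuit.toMatrix_append,
    ← mulVec_mulVec, ← mulVec_mulVec, ← mulVec_mulVec, hz]
  -- `X_t`, then `H_t`, then the Hadamard layer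
  rw [xWord_mulVec_layout, QCircuit.toMatrix_cons 0 (hOn (tgtWire n a)) ((addrWires n a).map hOn),
    ← mulVec_mulVec, hOn_tgt_mulVec_layout]
  simp only [Bool.not_false, if_true, neg_smul, one_smul]
  rw [mulVec_smul, mulVec_add, mulVec_neg, hadamards_mulVec_layout_zero,
    hadamards_mulVec_layout_zero, ← smul_neg, ← smul_add, smul_smul, ← sub_eq_add_neg, ← pow_succ']
  -- the oracle: phase kickback
  rw [mulVec_smul, revCompile_mulVec_layoutSum_sub f ops hops]
  -- `H_t`, then `X_t`
  rw [QCircuit.toMatrix_cons 0 (hOn (tgtWire n a)) (xWord (tgtWire n a)), ← mulVec_mulVec]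
  simp only [mulVec_smul, mulVec_finset_sum, hOn_tgt_mulVec_sub, xWord_mulVec_layout, Bool.not_true]
  rw [tensorVec_signVec_zeroState, ← invSqrt2_pow_succ_mul (n := n), ← smul_smul]
  simp only [Finset.smul_sum]
  refine Finset.sum_congr rfl fun x _ => ?_
  rw [smul_comm (if f x = true then (-1 : ℂ) else 1) (2 * invSqrt2)]

/-- **Exact sign-state synthesis (S3 of the sign-state route to Mehraban–Tahmasbi Thm 3.1).**
From an exact reversible oracle circuit `ops` for `f` on the layout `address ‖ target ‖ ancillas`
(`|x⟩|b⟩|0^a⟩ ↦ |x⟩|b ⊕ f(x)⟩|0^a⟩` for all `x, b`) one gets an oracle-free Clifford+`T` circuit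
with `T`-count at most `7 ·` (number of Toffoli gates of `ops`) preparing `|φ_f⟩ ⊗ |0^{1+a}⟩`
exactly from `|0…0⟩`. [cite: GossetKothariWu2024, Lemma 2.1 and Remark 2.2 (arXiv p. 8); NielsenChuang2010, §6.1.1] -/
theorem signState_exact_synthesis {n a : ℕ} (f : QReg n → Bool) (ops : List (RevOp (n + (1 + a))))
    (hops : ∀ (x : QReg n) (b : Bool), revEval ops (layout x b) = layout x (xor b (f x))) :
    ∃ U : QCircuit cliffordT (n + (1 + a)), U.IsOracleFree ∧ U.tCount ≤ 7 * toffCount ops ∧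
      U.toMatrix 0 *ᵥ zeroState (n + (1 + a)) = tensorVec (signVec f) (zeroState (1 + a)) :=
  ⟨kickbackCircuit ops, kickbackCircuit_isOracleFree ops, (tCount_kickbackCircuit ops).le,
    kickbackCircuit_mulVec_zeroState f ops hops⟩

end Kickback

end Literature.Computability.QuantumComplexity

end
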